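import Mathlib
import Literature.Analysis.FluidPDE.TaoEnstrophyLocalisation
import Literature.Analysis.FunctionSpaces.SobolevDomain
import HarnessLib

/-!
# Crux `EulerZoomLiouville.PowerGaugeEulerLiouville` (stmt-NavierStokesRegularity-19832), weak stratum, lines `weak_eulerian` (E1) /
# `weak_axisym` (X0): integrability of the pairings of the WEAK VORTICITY EQUATION

Route №10 `EulerZoomLiouville` (NavierStokesRegularity), crux E = stmt-NavierStokesRegularity-19832; width seat ns-ezl-w1 g9 under the LEAD ns-typeII-p2.
For `V ∈ L²_loc` with whole-space weak gradient `G ∈ L²_loc`, a.e. vorticity `Ω = curlCLM ∘ G ∈ L²_loc`, a scalar test `ψ`, a vector `e` and a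
continuous compactly supported field `Φ`, the pairings `φ⟪Ω,e⟫`, `⟪Ω,e⟫·Dψ[V]`, `Dψ[Ω]·⟪V,e⟫`, `ψ⟪GΩ,e⟫`, `⟪GΦ, V⟫` are integrable
(all vanish off a ball carrying the supports and are `L²·L²` there):
`integrable_of_eq_zero_off_ball`, `integrableOn_norm_mul_norm_ball`, `integrable_mul_inner_curlCLM`, `integrable_inner_curlCLM_mul_fderiv_apply`,
`integrable_fderiv_apply_curlCLM_mul_inner`, `integrable_mul_inner_apply_curlCLM`, `integrable_inner_apply_testField`. [folklore]

WHAT THIS IS NOT: not NS, not E — bookkeeping; 19832 is OPEN.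
-/

noncomputable section

-- flat `Theorems/<Route><Decl>…` files of one crux share the namespace of the crux (tree convention)
set_option linter.dupNamespace false

open MeasureTheory Set Filter Topology Metric Function TopologicalSpace
open scoped ENNReal NNReal RealInnerProductSpace ContDiff

namespace Summit.NavierStokesRegularity.NavierStokesRegularity.Theorems.PowerGaugeEulerLiouville.WeakEulerian

open Literature.Analysis Literature.Analysis.FunctionSpaces Literature.Analysis.FluidPDE
open Summit.NavierStokesRegularity.NavierStokesRegularity.Theorems.PowerGaugeEulerLiouville

variable {V : EuclideanSpace ℝ (Fin 3) → EuclideanSpace ℝ (Fin 3)}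
  {G : EuclideanSpace ℝ (Fin 3) → EuclideanSpace ℝ (Fin 3) →L[ℝ] EuclideanSpace ℝ (Fin 3)}
  {ψ : EuclideanSpace ℝ (Fin 3) → ℝ}

/-! ### Integrability bookkeeping -/

section Bookkeeping

/-- A function vanishing off a ball and dominated there by an integrable function is integrable. [folklore] -/
theorem integrable_of_eq_zero_off_ball {F : Type*} [NormedAddCommGroup F] {f : EuclideanSpace ℝ (Fin 3) → F} {R : ℝ}
    (hfm : AEStronglyMeasurable f volume) (hf0 : ∀ x, x ∉ ball (0 : EuclideanSpace ℝ (Fin 3)) R → f x = 0)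
    {g : EuclideanSpace ℝ (Fin 3) → ℝ} (hg : IntegrableOn g (ball (0 : EuclideanSpace ℝ (Fin 3)) R) volume)
    (hfg : ∀ x, x ∈ ball (0 : EuclideanSpace ℝ (Fin 3)) R → ‖f x‖ ≤ g x) : Integrable f volume := by
  have hsupp : support f ⊆ ball (0 : EuclideanSpace ℝ (Fin 3)) R := fun x hx => by
    by_contra h; exact hx (hf0 x h)
  rw [← integrableOn_iff_integrable_of_support_subset hsupp]
  exact Integrable.mono' hg hfm.restrict ((ae_restrict_mem measurableSet_ball).mono fun x hx => hfg x hx)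

/-- `‖f‖·‖g‖ ∈ L¹(B_r)` for `f, g ∈ L²(B_r)`. [folklore] -/
theorem integrableOn_norm_mul_norm_ball {F F' : Type*} [NormedAddCommGroup F] [NormedAddCommGroup F']
    {f : EuclideanSpace ℝ (Fin 3) → F} {g : EuclideanSpace ℝ (Fin 3) → F'} {r : ℝ}
    (hf : MemLp f 2 (volume.restrict (ball (0 : EuclideanSpace ℝ (Fin 3)) r)))
    (hg : MemLp g 2 (volume.restrict (ball (0 : EuclideanSpace ℝ (Fin 3)) r))) :
    IntegrableOn (fun x => ‖f x‖ * ‖g x‖) (ball (0 : EuclideanSpace ℝ (Fin 3)) r) volume :=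
  hf.norm.integrable_mul hg.norm

end Bookkeeping

/-! ### Integrability of the pairings (all supported in a ball carrying `tsupport ψ`) -/

section Integrability

/-- `x ↦ φ(x)⟪curlCLM(G x), e⟫` is integrable for a continuous compactly supported `φ` and `G ∈ L²_loc`. [folklore] -/
theorem integrable_mul_inner_curlCLM (hVG : HasWeakFDerivOn (⊤ : Opens (EuclideanSpace ℝ (Fin 3))) volume V G)
    (hG2 : ∀ r : ℝ, MemLp G 2 (volume.restrict (ball (0 : EuclideanSpace ℝ (Fin 3)) r)))
    {φ : EuclideanSpace ℝ (Fin 3) → ℝ} (hφc : Continuous φ) (hφs : HasCompactSupport φ) (e : EuclideanSpace ℝ (Fin 3)) :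
    Integrable (fun x => φ x * ⟪curlCLM (G x), e⟫) volume := by
  obtain ⟨R, hR⟩ := hφs.isCompact.isBounded.subset_ball (0 : EuclideanSpace ℝ (Fin 3))
  haveI : IsFiniteMeasure ((volume : Measure (EuclideanSpace ℝ (Fin 3))).restrict (ball (0 : EuclideanSpace ℝ (Fin 3)) R)) :=
    isFiniteMeasure_restrict.2 measure_ball_lt_top.ne
  have hGm : AEStronglyMeasurable G volume := (locallyIntegrableOn_univ.1 (by
    simpa only [Opens.coe_top] using hVG.locallyIntegrableOn_deriv)).aestronglyMeasurable
  have hΩm : AEStronglyMeasurable (fun x => curlCLM (G x)) volume := curlCLM.continuous.comp_aestronglyMeasurable hGm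
  obtain ⟨C, hC⟩ := hφc.bounded_above_of_compact_support hφs
  have hφ0 : ∀ x, x ∉ ball (0 : EuclideanSpace ℝ (Fin 3)) R → φ x = 0 := fun x hx =>
    image_eq_zero_of_notMem_tsupport fun h => hx (hR h)
  refine integrable_of_eq_zero_off_ball (hφc.aestronglyMeasurable.mul (hΩm.inner aestronglyMeasurable_const))
    (fun x hx => by rw [hφ0 x hx, zero_mul]) ((((curlCLM.comp_memLp' (hG2 R)).integrable one_le_two).norm).const_mul (C * ‖e‖))
    fun x _ => ?_
  rw [norm_mul]
  calc ‖φ x‖ * ‖⟪curlCLM (G x), e⟫‖ ≤ C * (‖curlCLM (G x)‖ * ‖e‖) := mul_le_mul (hC x) (norm_inner_le_norm _ _) (norm_nonneg _)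
        ((norm_nonneg _).trans (hC x))
    _ = C * ‖e‖ * ‖(⇑curlCLM ∘ G) x‖ := by simp only [Function.comp_apply]; ring

/-- `x ↦ ⟪curlCLM(G x), e⟫·Dψ(x)[V x]` is integrable (`L² · L²` on the ball carrying `tsupport ψ`). [folklore] -/
theorem integrable_inner_curlCLM_mul_fderiv_apply (hVG : HasWeakFDerivOn (⊤ : Opens (EuclideanSpace ℝ (Fin 3))) volume V G)
    (hV2 : ∀ r : ℝ, MemLp V 2 (volume.restrict (ball (0 : EuclideanSpace ℝ (Fin 3)) r)))
    (hG2 : ∀ r : ℝ, MemLp G 2 (volume.restrict (ball (0 : EuclideanSpace ℝ (Fin 3)) r)))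
    (hψ : IsTestFunctionOn (⊤ : Opens (EuclideanSpace ℝ (Fin 3))) ψ) (e : EuclideanSpace ℝ (Fin 3)) :
    Integrable (fun x => ⟪curlCLM (G x), e⟫ * fderiv ℝ ψ x (V x)) volume := by
  obtain ⟨R, hR⟩ := hψ.hasCompactSupport.isCompact.isBounded.subset_ball (0 : EuclideanSpace ℝ (Fin 3))
  have hGm : AEStronglyMeasurable G volume := (locallyIntegrableOn_univ.1 (by
    simpa only [Opens.coe_top] using hVG.locallyIntegrableOn_deriv)).aestronglyMeasurable
  have hVm : AEStronglyMeasurable V volume := (locallyIntegrableOn_univ.1 (by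
    simpa only [Opens.coe_top] using hVG.locallyIntegrableOn)).aestronglyMeasurable
  have hΩm : AEStronglyMeasurable (fun x => curlCLM (G x)) volume := curlCLM.continuous.comp_aestronglyMeasurable hGm
  have hDψc : Continuous (fderiv ℝ ψ) := hψ.contDiff.continuous_fderiv (by simp)
  obtain ⟨C, hC⟩ := hDψc.bounded_above_of_compact_support (hψ.hasCompactSupport.fderiv (𝕜 := ℝ))
  have hC0 : 0 ≤ C := (norm_nonneg _).trans (hC 0)
  have hDψ0 : ∀ x, x ∉ ball (0 : EuclideanSpace ℝ (Fin 3)) R → fderiv ℝ ψ x = 0 := fun x hx =>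
    fderiv_of_notMem_tsupport ℝ fun h => hx (hR h)
  have hDψVm : AEStronglyMeasurable (fun x => fderiv ℝ ψ x (V x)) volume :=
    Continuous.comp_aestronglyMeasurable₂ (g := fun (L : EuclideanSpace ℝ (Fin 3) →L[ℝ] ℝ) (v : EuclideanSpace ℝ (Fin 3)) => L v)
      (isBoundedBilinearMap_apply (𝕜 := ℝ) (E := EuclideanSpace ℝ (Fin 3)) (F := ℝ)).continuous hDψc.aestronglyMeasurable hVm
  refine integrable_of_eq_zero_off_ball ((hΩm.inner aestronglyMeasurable_const).mul hDψVm)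
    (fun x hx => by rw [hDψ0 x hx, _root_.zero_apply, mul_zero])
    ((integrableOn_norm_mul_norm_ball (curlCLM.comp_memLp' (hG2 R)) (hV2 R)).const_mul (‖e‖ * C)) fun x _ => ?_
  rw [norm_mul]
  have h1 : ‖⟪curlCLM (G x), e⟫‖ ≤ ‖curlCLM (G x)‖ * ‖e‖ := norm_inner_le_norm _ _
  have h2 : ‖fderiv ℝ ψ x (V x)‖ ≤ C * ‖V x‖ := ((fderiv ℝ ψ x).le_opNorm _).trans (mul_le_mul_of_nonneg_right (hC x) (norm_nonneg _))
  calc ‖⟪curlCLM (G x), e⟫‖ * ‖fderiv ℝ ψ x (V x)‖ ≤ (‖curlCLM (G x)‖ * ‖e‖) * (C * ‖V x‖) :=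
        mul_le_mul h1 h2 (norm_nonneg _) (by positivity)
    _ = ‖e‖ * C * (‖(⇑curlCLM ∘ G) x‖ * ‖V x‖) := by simp only [Function.comp_apply]; ring

/-- `x ↦ Dψ(x)[curlCLM(G x)]·⟪V x, e⟫` is integrable. [folklore] -/
theorem integrable_fderiv_apply_curlCLM_mul_inner (hVG : HasWeakFDerivOn (⊤ : Opens (EuclideanSpace ℝ (Fin 3))) volume V G)
    (hV2 : ∀ r : ℝ, MemLp V 2 (volume.restrict (ball (0 : EuclideanSpace ℝ (Fin 3)) r)))
    (hG2 : ∀ r : ℝ, MemLp G 2 (volume.restrict (ball (0 : EuclideanSpace ℝ (Fin 3)) r)))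
    (hψ : IsTestFunctionOn (⊤ : Opens (EuclideanSpace ℝ (Fin 3))) ψ) (e : EuclideanSpace ℝ (Fin 3)) :
    Integrable (fun x => fderiv ℝ ψ x (curlCLM (G x)) * ⟪V x, e⟫) volume := by
  obtain ⟨R, hR⟩ := hψ.hasCompactSupport.isCompact.isBounded.subset_ball (0 : EuclideanSpace ℝ (Fin 3))
  have hGm : AEStronglyMeasurable G volume := (locallyIntegrableOn_univ.1 (by
    simpa only [Opens.coe_top] using hVG.locallyIntegrableOn_deriv)).aestronglyMeasurable
  have hVm : AEStronglyMeasurable V volume := (locallyIntegrableOn_univ.1 (by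
    simpa only [Opens.coe_top] using hVG.locallyIntegrableOn)).aestronglyMeasurable
  have hΩm : AEStronglyMeasurable (fun x => curlCLM (G x)) volume := curlCLM.continuous.comp_aestronglyMeasurable hGm
  have hDψc : Continuous (fderiv ℝ ψ) := hψ.contDiff.continuous_fderiv (by simp)
  obtain ⟨C, hC⟩ := hDψc.bounded_above_of_compact_support (hψ.hasCompactSupport.fderiv (𝕜 := ℝ))
  have hC0 : 0 ≤ C := (norm_nonneg _).trans (hC 0)
  have hDψ0 : ∀ x, x ∉ ball (0 : EuclideanSpace ℝ (Fin 3)) R → fderiv ℝ ψ x = 0 := fun x hx =>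
    fderiv_of_notMem_tsupport ℝ fun h => hx (hR h)
  have hDψΩm : AEStronglyMeasurable (fun x => fderiv ℝ ψ x (curlCLM (G x))) volume :=
    Continuous.comp_aestronglyMeasurable₂ (g := fun (L : EuclideanSpace ℝ (Fin 3) →L[ℝ] ℝ) (v : EuclideanSpace ℝ (Fin 3)) => L v)
      (isBoundedBilinearMap_apply (𝕜 := ℝ) (E := EuclideanSpace ℝ (Fin 3)) (F := ℝ)).continuous hDψc.aestronglyMeasurable hΩm
  refine integrable_of_eq_zero_off_ball (hDψΩm.mul (hVm.inner aestronglyMeasurable_const))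
    (fun x hx => by rw [hDψ0 x hx, _root_.zero_apply, zero_mul])
    ((integrableOn_norm_mul_norm_ball (curlCLM.comp_memLp' (hG2 R)) (hV2 R)).const_mul (C * ‖e‖)) fun x _ => ?_
  rw [norm_mul]
  have h1 : ‖fderiv ℝ ψ x (curlCLM (G x))‖ ≤ C * ‖curlCLM (G x)‖ :=
    ((fderiv ℝ ψ x).le_opNorm _).trans (mul_le_mul_of_nonneg_right (hC x) (norm_nonneg _))
  have h2 : ‖⟪V x, e⟫‖ ≤ ‖V x‖ * ‖e‖ := norm_inner_le_norm _ _
  calc ‖fderiv ℝ ψ x (curlCLM (G x))‖ * ‖⟪V x, e⟫‖ ≤ (C * ‖curlCLM (G x)‖) * (‖V x‖ * ‖e‖) :=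
        mul_le_mul h1 h2 (norm_nonneg _) (by positivity)
    _ = C * ‖e‖ * (‖(⇑curlCLM ∘ G) x‖ * ‖V x‖) := by simp only [Function.comp_apply]; ring

/-- `x ↦ ψ(x)⟪G(x)(curlCLM(G x)), e⟫` is integrable (`L² · L²`). [folklore] -/
theorem integrable_mul_inner_apply_curlCLM (hVG : HasWeakFDerivOn (⊤ : Opens (EuclideanSpace ℝ (Fin 3))) volume V G)
    (hG2 : ∀ r : ℝ, MemLp G 2 (volume.restrict (ball (0 : EuclideanSpace ℝ (Fin 3)) r)))
    (hψ : IsTestFunctionOn (⊤ : Opens (EuclideanSpace ℝ (Fin 3))) ψ) (e : EuclideanSpace ℝ (Fin 3)) :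
    Integrable (fun x => ψ x * ⟪G x (curlCLM (G x)), e⟫) volume := by
  obtain ⟨R, hR⟩ := hψ.hasCompactSupport.isCompact.isBounded.subset_ball (0 : EuclideanSpace ℝ (Fin 3))
  have hGm : AEStronglyMeasurable G volume := (locallyIntegrableOn_univ.1 (by
    simpa only [Opens.coe_top] using hVG.locallyIntegrableOn_deriv)).aestronglyMeasurable
  have hΩm : AEStronglyMeasurable (fun x => curlCLM (G x)) volume := curlCLM.continuous.comp_aestronglyMeasurable hGm
  have hψc : Continuous ψ := hψ.contDiff.continuous
  obtain ⟨C, hC⟩ := hψc.bounded_above_of_compact_support hψ.hasCompactSupport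
  have hC0 : 0 ≤ C := (norm_nonneg _).trans (hC 0)
  have hψ0 : ∀ x, x ∉ ball (0 : EuclideanSpace ℝ (Fin 3)) R → ψ x = 0 := fun x hx =>
    image_eq_zero_of_notMem_tsupport fun h => hx (hR h)
  have hGΩm : AEStronglyMeasurable (fun x => G x (curlCLM (G x))) volume :=
    Continuous.comp_aestronglyMeasurable₂
      (g := fun (L : EuclideanSpace ℝ (Fin 3) →L[ℝ] EuclideanSpace ℝ (Fin 3)) (v : EuclideanSpace ℝ (Fin 3)) => L v)
      (isBoundedBilinearMap_apply (𝕜 := ℝ) (E := EuclideanSpace ℝ (Fin 3)) (F := EuclideanSpace ℝ (Fin 3))).continuous hGm hΩm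
  refine integrable_of_eq_zero_off_ball (hψc.aestronglyMeasurable.mul (hGΩm.inner aestronglyMeasurable_const))
    (fun x hx => by rw [hψ0 x hx, zero_mul])
    ((integrableOn_norm_mul_norm_ball (hG2 R) (curlCLM.comp_memLp' (hG2 R))).const_mul (C * ‖e‖)) fun x _ => ?_
  rw [norm_mul]
  have h2 : ‖⟪G x (curlCLM (G x)), e⟫‖ ≤ ‖G x‖ * ‖curlCLM (G x)‖ * ‖e‖ :=
    (norm_inner_le_norm _ _).trans (mul_le_mul_of_nonneg_right ((G x).le_opNorm _) (norm_nonneg _))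
  calc ‖ψ x‖ * ‖⟪G x (curlCLM (G x)), e⟫‖ ≤ C * (‖G x‖ * ‖curlCLM (G x)‖ * ‖e‖) := mul_le_mul (hC x) h2 (norm_nonneg _) hC0
    _ = C * ‖e‖ * (‖G x‖ * ‖(⇑curlCLM ∘ G) x‖) := by simp only [Function.comp_apply]; ring

/-- `x ↦ ⟪G(x)Φ(x), V x⟫` is integrable for a continuous compactly supported field `Φ` (`L² · L²`). [folklore] -/
theorem integrable_inner_apply_testField (hVG : HasWeakFDerivOn (⊤ : Opens (EuclideanSpace ℝ (Fin 3))) volume V G)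
    (hV2 : ∀ r : ℝ, MemLp V 2 (volume.restrict (ball (0 : EuclideanSpace ℝ (Fin 3)) r)))
    (hG2 : ∀ r : ℝ, MemLp G 2 (volume.restrict (ball (0 : EuclideanSpace ℝ (Fin 3)) r)))
    {Φ : EuclideanSpace ℝ (Fin 3) → EuclideanSpace ℝ (Fin 3)} (hΦc : Continuous Φ) (hΦs : HasCompactSupport Φ) :
    Integrable (fun x => ⟪G x (Φ x), V x⟫) volume := by
  obtain ⟨R, hR⟩ := hΦs.isCompact.isBounded.subset_ball (0 : EuclideanSpace ℝ (Fin 3))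
  have hGm : AEStronglyMeasurable G volume := (locallyIntegrableOn_univ.1 (by
    simpa only [Opens.coe_top] using hVG.locallyIntegrableOn_deriv)).aestronglyMeasurable
  have hVm : AEStronglyMeasurable V volume := (locallyIntegrableOn_univ.1 (by
    simpa only [Opens.coe_top] using hVG.locallyIntegrableOn)).aestronglyMeasurable
  obtain ⟨C, hC⟩ := hΦc.bounded_above_of_compact_support hΦs
  have hC0 : 0 ≤ C := (norm_nonneg _).trans (hC 0)
  have hΦ0 : ∀ x, x ∉ ball (0 : EuclideanSpace ℝ (Fin 3)) R → Φ x = 0 := fun x hx =>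
    image_eq_zero_of_notMem_tsupport fun h => hx (hR h)
  have hGΦm : AEStronglyMeasurable (fun x => G x (Φ x)) volume :=
    Continuous.comp_aestronglyMeasurable₂
      (g := fun (L : EuclideanSpace ℝ (Fin 3) →L[ℝ] EuclideanSpace ℝ (Fin 3)) (v : EuclideanSpace ℝ (Fin 3)) => L v)
      (isBoundedBilinearMap_apply (𝕜 := ℝ) (E := EuclideanSpace ℝ (Fin 3)) (F := EuclideanSpace ℝ (Fin 3))).continuous hGm
      hΦc.aestronglyMeasurable
  refine integrable_of_eq_zero_off_ball (hGΦm.inner hVm) (fun x hx => by rw [hΦ0 x hx, map_zero, inner_zero_left])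
    ((integrableOn_norm_mul_norm_ball (hG2 R) (hV2 R)).const_mul C) fun x _ => ?_
  calc ‖⟪G x (Φ x), V x⟫‖ ≤ ‖G x (Φ x)‖ * ‖V x‖ := norm_inner_le_norm _ _
    _ ≤ (‖G x‖ * C) * ‖V x‖ :=
        mul_le_mul_of_nonneg_right (((G x).le_opNorm _).trans (mul_le_mul_of_nonneg_left (hC x) (norm_nonneg _))) (norm_nonneg _)
    _ = C * (‖G x‖ * ‖V x‖) := by ring

end Integrability

end Summit.NavierStokesRegularity.NavierStokesRegularity.Theorems.PowerGaugeEulerLiouville.WeakEulerian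

end
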